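import Summits.BirchSwinnertonDyer.Rank1Residual.X2.CongruentLambdaShiftDerived
import Summits.BirchSwinnertonDyer.Rank1Residual.X2.GreenbergVatsalTorsionCurve
import HarnessLib

/-!
# The order of Greenberg–Vatsal's RESIDUAL non-primitive Selmer group:
# `#S^{Σ₀}_{E[p]}(ℚ_∞) = p^{λ(E) + Σ_{ℓ∈Σ₀} δ_E^{(ℓ)}} · #E(ℚ)[p]` at `μ = 0` (GV Prop. (2.8) with the
# `E(ℚ)[p]`-correction, in the kernel modulo the three printed §1/§2 statements)

HONEST FRAMING (BSD rank-`≤ 1` residual cell `b2b-bsdres`, home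
`run/shared/lean/b2b/bsd-rank1-residual/`, unit `b2b-bsdres-eisenstein-p2`, class X2; research route,
no claim beyond stated classes; nothing booked; labels unchanged): the cell deletes the
COMBINATION-SHAPED residual classes of the rank-`≤ 1` BSD formula from PUBLISHED theorems only and
TYPES the construction-shaped ones; this is not "finishing BSD". Theorems only (no definition, no
named fact, nothing asserted). Greenberg–Vatsal 2000 Prop. (2.8): at `μ = 0`,
"`λ(S^{Σ₀}_A(ℚ_∞)) = dim_{O/𝔪} S^{Σ₀}_{A[π]}(ℚ_∞)`" under `H⁰(ℚ, A[π]) = 0`; gen 8's kernel comparison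
(`GreenbergVatsalTorsionCurve.natCard_gvSelmerInfty_torsion_rat_goodOrdinary`) removed that
hypothesis at the price of the correction term `#E(ℚ_∞)[p^∞][p] = #E(ℚ)[p]`; gen 11's
`CongruentLambdaShiftDerived.natCard_gvSelmerInfty_inf_torsionBy_eq_pow` evaluates the uncorrected
order as `p^{λ + Σδ}`. Composing the two:

* **`natCard_gvSelmerInfty_torsionModule_eq`** — for `E/ℚ` globally minimal, `p` odd good ordinary,
  `κ` cyclotomic with a topological generator `γ`, `Σ₀ ∌ p` ⊇ bad primes, and any f.g. `Λ`-torsion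
  dual datum `D` with `μ(D.X) = 0`:
  `#S^{Σ₀}_{E[p^∞][p]}(ℚ_∞) = p^{λ(D.X) + Σ_{v∈Σ₀} δ_E^{(v)}} · #E(ℚ_∞)[p^∞][p]`;
* **`natCard_gvSelmerInfty_torsionModule_eq_rat`** — the same with the correction written as the
  number of `Γ_ℚ`-fixed `p`-torsion points, `#{m ∈ E[p^∞] : Γ_ℚ m = m, p m = 0} = #E(ℚ)[p]`.

This is the ℚ_∞-level formula "`dim_{𝔽_p} S^{Σ₀}_{E[p]}(ℚ_∞) = λ + Σ_ℓ s_ℓ d_ℓ + t`,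
`t = dim E(ℚ)[p]`" (this seat's ROUTE-G-REMARK-PROOF.md Claim R (ii), tested 33 232 times by the
route-G census without a violation; the target quantity of eisenstein-p1's route D, X1R0-GAPMAP §17)
— now a kernel theorem conditional on `imKummer_ge_greenbergCondition_at_p` (GV p. 26),
`lambda_nonPrimitive_eq_add_sum_delta` (GV (7)) and `divisible_nonPrimitiveSelmerInfty_of_mu_eq_zero`
(GV p. 8).

References: R. Greenberg, V. Vatsal, Invent. Math. 142 (2000), §1 (7), p. 8, §2 Prop. (2.8) and
pp. 25–27; R. Greenberg, LNM 1716 (1999), §1 p. 62 (`E(ℚ_∞)_tors`).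
-/

noncomputable section

open scoped Classical AddSubgroup

namespace Summit.BirchSwinnertonDyer.Rank1Residual.X2.ResidualSelmerCount

open NumberField IsDedekindDomain Field Literature.NumberTheory.GaloisRepresentations
  Literature.NumberTheory.EllipticCurves Literature.NumberTheory.EllipticCurves.GreenbergSelmer
  Literature.NumberTheory.EllipticCurves.GreenbergVatsal2000
  Summit.BirchSwinnertonDyer.Rank1Residual.X2.GreenbergVatsalTorsion
  Summit.BirchSwinnertonDyer.Rank1Residual.X2.GreenbergVatsalTorsionCurve
  Summit.BirchSwinnertonDyer.Rank1Residual.X2.GreenbergVatsalReductionDatum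
  Summit.BirchSwinnertonDyer.Rank1Residual.X2.CongruentLambdaShiftDerived

open WeierstrassCurve (minimalDiscriminantInt)

variable (W : WeierstrassCurve ℚ) [W.IsElliptic] [W.IsGloballyMinimal] {p : ℕ} [hp : Fact p.Prime]
  {κ : ZpExtension ℚ p} {γ : absoluteGaloisGroup ℚ} (S₀ : Finset (HeightOneSpectrum (𝓞 ℚ)))

/-- **`#S^{Σ₀}_{E[p^∞][p]}(ℚ_∞) = p^{λ(E) + Σ_{v∈Σ₀} δ_E^{(v)}} · #E(ℚ_∞)[p^∞][p]`** — the order of the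
RESIDUAL non-primitive Selmer group (Greenberg's data `C_p = ker(E[p^∞] → Ẽ)` reduced mod `p`,
`torsionData`) at `μ = 0`: gen 8's corrected GV Prop. (2.8)
(`natCard_gvSelmerInfty_torsion_rat_goodOrdinary`: `#S^{Σ₀}_{A[p]} = #(S^{Σ₀}_A ⊓ H¹[p]) · #A^H[p]`)
composed with `#(S^{Σ₀}_A ⊓ H¹[p]) = p^{λ + Σδ}` (`natCard_gvSelmerInfty_inf_torsionBy_eq_pow`).
[cite: GreenbergVatsal2000, §2 Prop. (2.8) (pp. 25–27) and §1 (7), p. 8] -/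
theorem natCard_gvSelmerInfty_torsionModule_eq (hGV : imKummer_ge_greenbergCondition_at_p)
    (hA : lambda_nonPrimitive_eq_add_sum_delta) (hB : divisible_nonPrimitiveSelmerInfty_of_mu_eq_zero)
    (hp2 : p ≠ 2) (hgood : W.HasGoodReductionAtPrime p) (hord : ¬ (p : ℤ) ∣ W.frobeniusTrace p)
    (hκ : κ.IsCyclotomic) (hγ : κ.IsTopGenerator γ)
    (hS₀ : ∀ v ∈ S₀, ((p : ℕ) : 𝓞 ℚ) ∉ v.asIdeal)
    (hbad : ∀ v : HeightOneSpectrum (𝓞 ℚ), v ∉ S₀ → ((p : ℕ) : 𝓞 ℚ) ∉ v.asIdeal →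
      W.HasGoodReductionAt v)
    (D : W.SelmerDualData κ γ) [Module.Finite (IwasawaAlgebra p) D.X] (hX : D.IsTorsion)
    (hμ : D.mu = 0) (hΔ : ¬ (p : ℤ) ∣ minimalDiscriminantInt W) :
    Nat.card (gvSelmerInfty κ ((W.geomPrimaryTorsion p)[(p : ℤ)])
        (torsionData (reductionData W p hΔ) p) (↑S₀ : Set (HeightOneSpectrum (𝓞 ℚ)))) =
      p ^ (lambdaInvariant p D.X + ∑ v ∈ S₀, delta W p v) *
        Nat.card ((FixedPoints.addSubgroup κ.kerSubgroup (W.geomPrimaryTorsion p))[(p : ℤ)]) := by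
  rw [natCard_gvSelmerInfty_torsion_rat_goodOrdinary W κ (reductionData W p hΔ)
      (↑S₀ : Set (HeightOneSpectrum (𝓞 ℚ))) hp2 hgood hord hκ hbad (reductionData_htriv W p hΔ),
    natCard_gvSelmerInfty_inf_torsionBy_eq_pow W S₀ hGV hA hB hp2 hgood hord hκ hγ hS₀ hbad D hX hμ hΔ]

/-- **The same with the correction as `#E(ℚ)[p]`**: the number of `Γ_ℚ`-fixed `p`-torsion points of
`E[p^∞]` (`natCard_fixedPoints_torsion_eq_rat`: `E(ℚ_∞)[p^∞] = E(ℚ)[p^∞]` at an odd good ordinary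
`p`, Mazur 6.12 / Greenberg p. 62) — "`dim_{𝔽_p} S^{Σ₀}_{E[p]}(ℚ_∞) = λ_E + Σ_ℓ s_ℓ d_ℓ + t`,
`t = dim E(ℚ)[p]`" (route G's Claim R (ii); the quantity route D bounds from below).
[cite: GreenbergVatsal2000, §2 Prop. (2.8) (pp. 25–27)] [cite: GreenbergLNM1716, §1 p. 62] -/
theorem natCard_gvSelmerInfty_torsionModule_eq_rat (hGV : imKummer_ge_greenbergCondition_at_p)
    (hA : lambda_nonPrimitive_eq_add_sum_delta) (hB : divisible_nonPrimitiveSelmerInfty_of_mu_eq_zero)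
    (hp2 : p ≠ 2) (hgood : W.HasGoodReductionAtPrime p) (hord : ¬ (p : ℤ) ∣ W.frobeniusTrace p)
    (hκ : κ.IsCyclotomic) (hγ : κ.IsTopGenerator γ)
    (hS₀ : ∀ v ∈ S₀, ((p : ℕ) : 𝓞 ℚ) ∉ v.asIdeal)
    (hbad : ∀ v : HeightOneSpectrum (𝓞 ℚ), v ∉ S₀ → ((p : ℕ) : 𝓞 ℚ) ∉ v.asIdeal →
      W.HasGoodReductionAt v)
    (D : W.SelmerDualData κ γ) [Module.Finite (IwasawaAlgebra p) D.X] (hX : D.IsTorsion)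
    (hμ : D.mu = 0) (hΔ : ¬ (p : ℤ) ∣ minimalDiscriminantInt W) :
    Nat.card (gvSelmerInfty κ ((W.geomPrimaryTorsion p)[(p : ℤ)])
        (torsionData (reductionData W p hΔ) p) (↑S₀ : Set (HeightOneSpectrum (𝓞 ℚ)))) =
      p ^ (lambdaInvariant p D.X + ∑ v ∈ S₀, delta W p v) *
        Nat.card {m : W.geomPrimaryTorsion p //
          (∀ σ : absoluteGaloisGroup ℚ, σ • m = m) ∧ p • m = 0} := by
  rw [natCard_gvSelmerInfty_torsionModule_eq W S₀ hGV hA hB hp2 hgood hord hκ hγ hS₀ hbad D hX hμ hΔ,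
    natCard_fixedPoints_torsion_eq_rat W κ hp2 hgood hord hκ]

end Summit.BirchSwinnertonDyer.Rank1Residual.X2.ResidualSelmerCount

end
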